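import Summits.CriticalPhenomena.PercolationContinuityZ3.Theorems.PercNearOneGluingNoHeavyLowerTailUniformCertLeFive

/-!
# `NoHeavyLowerTail` (crux stmt-CriticalPhenomena-4575 ≡ KN Conjecture 3), certificate programme:
# the LEVEL-POLYNOMIAL partition dynamic programme and its certified leaf check
# (infrastructure for additive gluing at EVERY uniform density on seven vertices)

The all-density certificate `…UniformCertLeSix.lean` checks each graph from the reach tables of
ALL its `2^m` sub-configurations (`lvTabs`); at seven vertices (`2^21` sub-configurations of `K₇`,
`1044` isomorphism classes) that leaf is out of budget.  This file replaces it by the cluster-PARTITION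
dynamic programme of `CertSearch.lean` (`stepH`: `≤ Bell(n)`-ish weighted labellings per graph, shared
along prefixes of the search) in which the integer count of a labelling is refined to a LEVEL
POLYNOMIAL — the list `k ↦ #{sub-configurations with k open pairs gluing to this labelling}`:

* `polyAdd`, `pushP`, `coalesceP`, `stepHP d u v` — one present pair: closed (polynomial unchanged) or
  open (glue `u v`, shift the polynomial by one level); keyed merge sort and coalescing as in `stepH`;
* the leaf check `checkLP n d`: per source `o` the histogram `histP` of level polynomials indexed by
  the block mask of `o` (cf. `CertSearchH.histA`), the AVOID TABLES `avTab`/`avTabs`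
  (`av[o][X]` = level polynomial of `{block of o misses X}` = `k ↦ #_k{C(o) ∩ X = ∅}`, `avoidP`), and
  the level test `checkAv`: for all `o ≠ b`, `A ∌ o`, `A ≠ ∅`,
  `∃ a ∈ A, ∀ k, #_k{o ↮ b} ≤ #_k{o ↮ b, o ↮ A} + #_k{a ↮ b}` (`polyLe3`), i.e. the GRADED form
  `#_k{o ↔ A, o ↮ b} ≤ #_k{a ↮ b}` of additive gluing, which by the bridge
  `…UniformLevelCounting.lean` gives additive gluing at every `p ∈ [0, 1]`;
* soundness of the data: `wcntP_foldl_stepHP_init` (THE COUNTING SEMANTICS: for every test `Q` of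
  (labelling, level), the `Q`-count of the states reached from `[(range n, [1])]` along `es` is
  `#{ω ⊆ es : Q (labOfL n ω) |ω|}`), `polyCnt_histP`, `polyCnt_avoidP`, `sum_range_ite_wcntP` (fibre
  counting), `blockMask_labOfL_eq` (block mask = reach mask), `getD_avTab` (the avoid tables ARE the
  level counts `lvCnt` of `…UniformCertLeFiveChecker.lean`), and `checkLP_spec` (what a passed leaf
  says, in `lvCnt` form — the hypothesis shape of `lvCnt_eq_card`);
* the anchor `additiveGluing_uniform_completeFive` (registered stub; the case `G = ⊤` on `Fin 5` of
  the landed `additiveGluing_uniform_le_five`).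

The block-pruned search over all graphs on `Fin 7` with this leaf, its soundness and the certificate
are in `…UniformCertLeSeven.lean`.  Nothing here asserts or refutes the crux; no proposition is
defined (only computable functions on lists of naturals).
-/

namespace Summit.CriticalPhenomena.PercolationContinuityZ3.Theorems

open Summit.CriticalPhenomena.PercolationContinuityZ3.Theorems.AdditiveGluing.Negative.Cert

/-! ## Part 1. The level-polynomial dynamic programme and the leaf check (computable) -/

section Checker

/-- Coefficient-wise sum of two level polynomials (lists of level counts; missing entries are `0`). -/
def polyAdd : List ℕ → List ℕ → List ℕ
  | [], ys => ys
  | x :: xs, [] => x :: xs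
  | x :: xs, y :: ys => (x + y) :: polyAdd xs ys

/-- Push a (labelling, level polynomial) state, adding the polynomials if the head carries the
same labelling. -/
def pushP (e : List ℕ × List ℕ) : List (List ℕ × List ℕ) → List (List ℕ × List ℕ)
  | [] => [e]
  | e' :: d => if e.1 = e'.1 then (e.1, polyAdd e.2 e'.2) :: d else e :: e' :: d

/-- Coalesce adjacent equal labellings. -/
def coalesceP (d : List (List ℕ × List ℕ)) : List (List ℕ × List ℕ) := d.foldr pushP []

/-- One PRESENT pair `(u, v)`: closed (polynomial unchanged) or open (glue; shift the polynomial
by one level); keyed merge sort, coalesce. -/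
def stepHP (d : List (List ℕ × List ℕ)) (u v : ℕ) : List (List ℕ × List ℕ) :=
  coalesceP ((List.mergeSort ((d ++ d.map fun e => (mergeLab e.1 u v, 0 :: e.2)).map
    fun e => (labKey e.1, e)) (fun a b => Nat.ble a.1 b.1)).map fun ke => ke.2)

/-- Coefficient-wise test `x_k ≤ y_k + z_k` for all `k` (missing coefficients are `0`). -/
def polyLe3 : List ℕ → List ℕ → List ℕ → Bool
  | [], _, _ => true
  | x :: xs, ys, zs => decide (x ≤ ys.headD 0 + zs.headD 0) && polyLe3 xs ys.tail zs.tail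

/-- One histogram step for the source `o`: add the polynomial of a state at the index of its
block mask of `o`. -/
def histStepP (n o : ℕ) (h : Array (List ℕ)) (t : Array ℕ × List ℕ) : Array (List ℕ) :=
  if hm : blockMaskA n t.1 o < h.size then
    h.set (blockMaskA n t.1 o) (polyAdd t.2 h[blockMaskA n t.1 o]) hm else h

/-- The histogram of level polynomials of the block mask of `o` over the states (indices `< 2^n`). -/
def histP (n : ℕ) (da : List (Array ℕ × List ℕ)) (o : ℕ) : Array (List ℕ) :=
  da.foldl (histStepP n o) (Array.replicate (2 ^ n) [])

/-- `Σ_{T : T ∩ X = ∅} hist[T]`: the level polynomial of `{block of o misses X}`. -/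
def avoidP (h : Array (List ℕ)) (X : ℕ) : List ℕ :=
  (List.range h.size).foldr
    (fun T acc => if T &&& X == 0 then polyAdd ((h[T]?).getD []) acc else acc) []

/-- The avoid table of the histogram `h`: entry `X < 2^n` = level polynomial of
`{block of o misses X}`. -/
def avTab (n : ℕ) (h : Array (List ℕ)) : Array (List ℕ) :=
  ((List.range (2 ^ n)).map fun X => avoidP h X).toArray

/-- The avoid tables of all sources `o < n`, from the (labelling as an array, level polynomial)
states. -/
def avTabs (n : ℕ) (da : List (Array ℕ × List ℕ)) : List (Array (List ℕ)) :=
  (List.range n).map fun o => avTab n (histP n da o)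

/-- The level test on the avoid tables `av` (`av[o][X]` = level polynomial of
`{block of o misses X}`): for all `o ≠ b` and every `A` (mask `Am`) with `A ≠ ∅`, `o ∉ A`,
`∃ a ∈ A, ∀ k, #_k{o ↮ b} ≤ #_k{o ↮ b, o ↮ A} + #_k{a ↮ b}`. -/
def checkAv (n : ℕ) (av : List (Array (List ℕ))) : Bool :=
  (List.range n).all fun o =>
    let avo := av.getD o #[]
    (List.range n).all fun b => o == b ||
      (List.range (2 ^ n)).all fun Am => Am == 0 || Am.testBit o ||
        (List.range n).any fun a => Am.testBit a &&
          polyLe3 ((avo[2 ^ b]?).getD []) ((avo[2 ^ b ||| Am]?).getD [])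
            (((av.getD a #[])[2 ^ b]?).getD [])

/-- THE LEAF CHECK for one graph from its (labelling, level polynomial) states. -/
def checkLP (n : ℕ) (d : List (List ℕ × List ℕ)) : Bool :=
  checkAv n (avTabs n (d.map fun e => (e.1.toArray, e.2)))

/-- Specification: the `q`-count `Σ_k [q k] · poly[k]` of a level polynomial. -/
def polyCnt (q : ℕ → Bool) : List ℕ → ℕ
  | [] => 0
  | c :: cs => (if q 0 then c else 0) + polyCnt (fun k => q (k + 1)) cs

/-- Specification: the `Q`-count `Σ_{(s, poly)} Σ_k [Q s k] · poly[k]` of a list of states. -/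
def wcntP (Q : List ℕ → ℕ → Bool) (d : List (List ℕ × List ℕ)) : ℕ :=
  (d.map fun e => polyCnt (Q e.1) e.2).sum

end Checker

/-! ## Part 2. Level polynomials -/

/-- `polyCnt` is additive under `polyAdd`. -/
theorem polyCnt_polyAdd : ∀ (q : ℕ → Bool) (xs ys : List ℕ),
    polyCnt q (polyAdd xs ys) = polyCnt q xs + polyCnt q ys
  | q, [], ys => by simp [polyAdd, polyCnt]
  | q, x :: xs, [] => by simp [polyAdd, polyCnt]
  | q, x :: xs, y :: ys => by
    rw [polyAdd, polyCnt, polyCnt, polyCnt, polyCnt_polyAdd]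
    split_ifs <;> omega

/-- The count of the constant test `false` vanishes. -/
theorem polyCnt_false : ∀ (p : List ℕ), polyCnt (fun _ => false) p = 0
  | [] => rfl
  | c :: cs => by rw [polyCnt, polyCnt_false cs]; simp

/-- Prepending a zero coefficient shifts the test. -/
theorem polyCnt_cons_zero (q : ℕ → Bool) (cs : List ℕ) :
    polyCnt q (0 :: cs) = polyCnt (fun k => q (k + 1)) cs := by
  rw [polyCnt, ite_self, zero_add]

/-- Coefficient `k` is the count of the test `· == k`. -/
theorem polyCnt_beq : ∀ (p : List ℕ) (k : ℕ), polyCnt (fun k' => k' == k) p = p.getD k 0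
  | [], k => by simp [polyCnt]
  | c :: cs, 0 => by
    have h0 : (fun k' : ℕ => k' + 1 == 0) = fun _ => false := by funext k'; simp
    simp only [polyCnt, beq_self_eq_true, if_true, List.getD_cons_zero, h0, polyCnt_false, add_zero]
  | c :: cs, k + 1 => by
    have h1 : (fun k' : ℕ => k' + 1 == k + 1) = fun k' => k' == k := by funext k'; simp
    simp only [polyCnt, List.getD_cons_succ, h1, polyCnt_beq cs k]
    simp

/-- What `polyLe3 x y z = true` says: `x_k ≤ y_k + z_k` for every `k`. -/
theorem polyLe3_getD : ∀ (x y z : List ℕ), polyLe3 x y z = true → ∀ k, x.getD k 0 ≤ y.getD k 0 + z.getD k 0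
  | [], _, _, _, k => by simp
  | a :: x, y, z, h, k => by
    rw [polyLe3, Bool.and_eq_true, decide_eq_true_eq] at h
    cases k with
    | zero => cases y <;> cases z <;> simpa using h.1
    | succ k =>
      have := polyLe3_getD x y.tail z.tail h.2 k
      cases y <;> cases z <;> simpa using this

/-! ## Part 3. The dynamic programme counts sub-configurations by labelling and level -/

/-- `wcntP` of a cons. -/
theorem wcntP_cons (Q : List ℕ → ℕ → Bool) (e : List ℕ × List ℕ) (d : List (List ℕ × List ℕ)) :
    wcntP Q (e :: d) = polyCnt (Q e.1) e.2 + wcntP Q d := by simp [wcntP]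

/-- Pushing preserves counts. -/
theorem wcntP_pushP (Q : List ℕ → ℕ → Bool) (e : List ℕ × List ℕ) (d : List (List ℕ × List ℕ)) :
    wcntP Q (pushP e d) = polyCnt (Q e.1) e.2 + wcntP Q d := by
  cases d with
  | nil => simp [pushP, wcntP]
  | cons e' d =>
    simp only [pushP]
    by_cases h : e.1 = e'.1
    · rw [if_pos h, wcntP_cons, wcntP_cons]
      dsimp only
      rw [polyCnt_polyAdd, h]
      ring
    · rw [if_neg h, wcntP_cons]

/-- Coalescing preserves counts. -/
theorem wcntP_coalesceP (Q : List ℕ → ℕ → Bool) :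
    ∀ d : List (List ℕ × List ℕ), wcntP Q (coalesceP d) = wcntP Q d
  | [] => rfl
  | e :: d => by
    rw [coalesceP, List.foldr_cons, wcntP_pushP, ← coalesceP, wcntP_coalesceP Q d, wcntP_cons]

/-- Counts of one step: unchanged states plus glued states one level up. -/
theorem wcntP_stepHP (Q : List ℕ → ℕ → Bool) (d : List (List ℕ × List ℕ)) (u v : ℕ) :
    wcntP Q (stepHP d u v) = wcntP Q d + wcntP (fun s k => Q (mergeLab s u v) (k + 1)) d := by
  rw [stepHP, wcntP_coalesceP]
  have hperm := ((List.mergeSort_perm ((d ++ d.map fun e => (mergeLab e.1 u v, 0 :: e.2)).map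
    fun e => (labKey e.1, e)) (fun a b => Nat.ble a.1 b.1)).map fun ke => ke.2)
  rw [List.map_map] at hperm
  have hid : ((fun ke : ℕ × (List ℕ × List ℕ) => ke.2) ∘ fun e : List ℕ × List ℕ => (labKey e.1, e)) = id := by
    funext e; rfl
  rw [hid, List.map_id] at hperm
  unfold wcntP
  rw [(hperm.map _).sum_eq]
  simp only [List.map_append, List.map_map, List.sum_append, Function.comp_def, polyCnt_cons_zero]

/-- **The dynamic programme is exact**: after processing `es` from `d`, the `Q`-count is the sum over
the sub-lists `ω` of `es` of the counts of `d` for `Q` glued along `ω` (from the left) and shifted by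
`|ω|` levels. -/
theorem wcntP_foldl_stepHP {n : ℕ} : ∀ (es : List (Fin n × Fin n)) (d : List (List ℕ × List ℕ))
    (Q : List ℕ → ℕ → Bool),
    wcntP Q (es.foldl (fun d q => stepHP d q.1 q.2) d) =
      (es.sublists'.map fun ω => wcntP
        (fun s k => Q (ω.foldl (fun lab p => mergeLab lab p.1 p.2) s) (k + ω.length)) d).sum
  | [], d, Q => by
    simp only [List.foldl_nil, List.sublists'_nil, List.map_cons, List.map_nil, List.sum_cons,
      List.sum_nil, Nat.add_zero, List.length_nil]
  | p :: es, d, Q => by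
    rw [List.foldl_cons, wcntP_foldl_stepHP es, List.sublists'_cons, List.map_append, List.sum_append,
      List.map_map]
    have h : (es.sublists'.map fun ω => wcntP
        (fun s k => Q (ω.foldl (fun lab p => mergeLab lab p.1 p.2) s) (k + ω.length)) (stepHP d p.1 p.2)) =
        es.sublists'.map fun ω =>
          wcntP (fun s k => Q (ω.foldl (fun lab p => mergeLab lab p.1 p.2) s) (k + ω.length)) d +
          wcntP (fun s k => Q ((p :: ω).foldl (fun lab p => mergeLab lab p.1 p.2) s)
            (k + (p :: ω).length)) d :=
      List.map_congr_left fun ω _ => by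
        rw [wcntP_stepHP]
        simp only [List.foldl_cons, List.length_cons, Nat.add_assoc, Nat.add_comm 1]
    rw [h, List.sum_map_add]
    rfl

/-- From the initial state `[(range n, [1])]`: the `Q`-count is the number of sub-lists `ω` with
`Q (labOfL n ω) |ω|`. -/
theorem wcntP_foldl_stepHP_init {n : ℕ} (es : List (Fin n × Fin n)) (Q : List ℕ → ℕ → Bool) :
    wcntP Q (es.foldl (fun d q => stepHP d q.1 q.2) [(List.range n, [1])]) =
      es.sublists'.countP fun ω => Q (labOfL n ω) ω.length := by
  rw [wcntP_foldl_stepHP, countP_eq_sum_map_ite]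
  congr 1
  refine List.map_congr_left fun ω _ => ?_
  simp only [wcntP, List.map_cons, List.map_nil, List.sum_cons, List.sum_nil, polyCnt, labOfL,
    Nat.zero_add, add_zero]
  rfl

/-! ## Part 4. Semantics of the histogram and of the avoid tables -/

/-- Size of the histogram. -/
theorem size_histP (n : ℕ) (da : List (Array ℕ × List ℕ)) (o : ℕ) : (histP n da o).size = 2 ^ n := by
  unfold histP
  suffices h : ∀ (l : List (Array ℕ × List ℕ)) (h₀ : Array (List ℕ)),
      (l.foldl (histStepP n o) h₀).size = h₀.size by
    rw [h, Array.size_replicate]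
  intro l
  induction l with
  | nil => intro h₀; rfl
  | cons t l ih =>
    intro h₀
    rw [List.foldl_cons, ih]
    unfold histStepP
    split_ifs <;> simp

/-- Entries of the histogram: for `T < 2^n`, entry `T` counts (for every level test `q`) the states
whose block mask of `o` is `T`. -/
theorem polyCnt_histP (n : ℕ) (d : List (List ℕ × List ℕ)) (o T : ℕ) (hT : T < 2 ^ n) (q : ℕ → Bool) :
    polyCnt q (((histP n (d.map fun e => (e.1.toArray, e.2)) o)[T]?).getD []) =
      wcntP (fun s k => blockMask n s o == T && q k) d := by
  unfold histP
  suffices h : ∀ (l : List (List ℕ × List ℕ)) (h₀ : Array (List ℕ)), h₀.size = 2 ^ n →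
      polyCnt q ((((l.map fun e => (e.1.toArray, e.2)).foldl (histStepP n o) h₀)[T]?).getD []) =
        polyCnt q ((h₀[T]?).getD []) + wcntP (fun s k => blockMask n s o == T && q k) l by
    rw [h _ _ (Array.size_replicate ..), Array.getElem?_replicate, if_pos hT, Option.getD_some, polyCnt,
      zero_add]
  intro l
  induction l with
  | nil => intro h₀ _; simp [wcntP]
  | cons t l ih =>
    intro h₀ hsz
    have hsz' : (histStepP n o h₀ (t.1.toArray, t.2)).size = 2 ^ n := by
      unfold histStepP; split_ifs <;> simp [hsz]
    rw [List.map_cons, List.foldl_cons, ih _ hsz', wcntP_cons, ← add_assoc]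
    congr 1
    have hm : blockMaskA n t.1.toArray o < h₀.size := by
      rw [blockMaskA_toArray, hsz]; exact blockMask_lt n t.1 o
    unfold histStepP
    rw [dif_pos hm]
    simp only [blockMaskA_toArray]
    by_cases hmt : blockMask n t.1 o = T
    · subst hmt
      rw [Array.getElem?_set_self (by rw [hsz]; exact blockMask_lt n t.1 o)]
      simp only [Option.getD_some, beq_self_eq_true, Bool.true_and, polyCnt_polyAdd]
      rw [Array.getElem_eq_getElem?_get, Option.get_eq_getD, Nat.add_comm]
    · rw [Array.getElem?_set_ne (by rw [hsz]; exact blockMask_lt n t.1 o) hmt]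
      simp [beq_eq_false_iff_ne.2 hmt, polyCnt_false]

/-- The avoid polynomial counts, for every level test `q`, the rows `T` with `T ∩ X = ∅`. -/
theorem polyCnt_avoidP (q : ℕ → Bool) (h : Array (List ℕ)) (X : ℕ) :
    polyCnt q (avoidP h X) =
      ((List.range h.size).map fun T => if T &&& X == 0 then polyCnt q ((h[T]?).getD []) else 0).sum := by
  unfold avoidP
  generalize List.range h.size = L
  induction L with
  | nil => simp [polyCnt]
  | cons T L ih =>
    rw [List.foldr_cons, List.map_cons, List.sum_cons, ← ih]
    split_ifs with hT
    · rw [polyCnt_polyAdd]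
    · rw [zero_add]

/-- Fibre counting for the states: summing the `T`-fibres selected by `Q` gives the `Q`-count. -/
theorem sum_range_ite_wcntP (n o : ℕ) (Q : ℕ → Bool) (q : ℕ → Bool) : ∀ d : List (List ℕ × List ℕ),
    (∑ T ∈ Finset.range (2 ^ n),
        if Q T then wcntP (fun s k => blockMask n s o == T && q k) d else 0) =
      wcntP (fun s k => Q (blockMask n s o) && q k) d
  | [] => by simp [wcntP]
  | t :: d => by
    simp only [wcntP_cons]
    rw [← sum_range_ite_wcntP n o Q q d]
    have hsplit : ∀ T ∈ Finset.range (2 ^ n),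
        (if Q T = true then polyCnt (fun k => blockMask n t.1 o == T && q k) t.2 +
            wcntP (fun s k => blockMask n s o == T && q k) d else 0) =
        (if blockMask n t.1 o = T then (if Q T = true then polyCnt q t.2 else 0) else 0) +
          (if Q T = true then wcntP (fun s k => blockMask n s o == T && q k) d else 0) := by
      intro T _
      by_cases hQ : Q T = true <;> by_cases hb : blockMask n t.1 o = T
      · subst hb; simp [hQ]
      · simp [hQ, hb, beq_eq_false_iff_ne.2 hb, polyCnt_false]
      · subst hb; simp [hQ]
      · simp [hQ]
    rw [Finset.sum_congr rfl hsplit, Finset.sum_add_distrib, Finset.sum_ite_eq,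
      if_pos (Finset.mem_range.2 (blockMask_lt n t.1 o))]
    by_cases hQ : Q (blockMask n t.1 o) = true
    · simp [hQ]
    · simp [hQ, polyCnt_false]

/-- The block mask of `o` in the left-labelling IS the reach mask of `o`. -/
theorem blockMask_labOfL_eq {n : ℕ} (ω : List (Fin n × Fin n)) (o : Fin n) :
    blockMask n (labOfL n ω) o = (reachTable n ω).getD o 0 :=
  Nat.eq_of_testBit_eq fun i => by rw [Bool.eq_iff_iff, testBit_blockMask_labOfL_iff]

/-- **The avoid tables are the level counts.** For the states of the edge list `es` (from the initial
state), a source `o < n` and an avoid mask `X < 2^n`: coefficient `k` of `av[o][X]` is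
`lvCnt n es o (· ∩ X = ∅) k = #{ω ⊆ es : |ω| = k, C_ω(o) ∩ X = ∅}`. -/
theorem getD_avTab {n : ℕ} (es : List (Fin n × Fin n)) (o : Fin n) {X : ℕ} (hX : X < 2 ^ n) (k : ℕ) :
    (((avTab n (histP n ((es.foldl (fun d q => stepHP d q.1 q.2) [(List.range n, [1])]).map
        fun e => (e.1.toArray, e.2)) o))[X]?).getD []).getD k 0 =
      lvCnt n es o (fun T => T &&& X == 0) k := by
  set D := es.foldl (fun d q => stepHP d q.1 q.2) [(List.range n, [1])] with hD
  rw [avTab, List.getElem?_toArray, List.getElem?_map, List.getElem?_range hX, Option.map_some,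
    Option.getD_some, ← polyCnt_beq, polyCnt_avoidP, size_histP, sum_map_range_eq]
  have h1 : ∀ T ∈ Finset.range (2 ^ n),
      (if (T &&& X == 0) = true then
        polyCnt (fun k' => k' == k) (((histP n (D.map fun e => (e.1.toArray, e.2)) o)[T]?).getD []) else 0) =
      if (T &&& X == 0) = true then wcntP (fun s k' => blockMask n s o == T && k' == k) D else 0 :=
    fun T hT => by rw [polyCnt_histP n D o T (Finset.mem_range.1 hT)]
  have h2 := sum_range_ite_wcntP n o (fun T => T &&& X == 0) (fun k' => k' == k) D
  rw [Finset.sum_congr rfl h1, h2, hD, wcntP_foldl_stepHP_init, lvCnt, lvTabs, List.countP_map]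
  exact List.countP_congr fun ω _ => by simp only [Function.comp_apply, blockMask_labOfL_eq]

/-! ## Part 5. What a passed leaf says -/

/-- **What `checkLP` guarantees** for the states of an edge list `es`: for `o ≠ b`, `A ≠ ∅`
(mask `Am < 2^n`), `o ∉ A`, some relay `a ∈ A` has, at every level `k`,
`#_k{o ↮ b} ≤ #_k{o ↮ b, o ↮ A} + #_k{a ↮ b}` (level counts in `lvCnt` form: the reach mask of the
source misses `{b}`, resp. `{b} ∪ A`). -/
theorem checkLP_spec {n : ℕ} {es : List (Fin n × Fin n)}
    (h : checkLP n (es.foldl (fun d q => stepHP d q.1 q.2) [(List.range n, [1])]) = true)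
    (o b : Fin n) (hob : o ≠ b) {Am : ℕ} (hAm : Am < 2 ^ n) (hAm0 : Am ≠ 0) (hAo : Am.testBit o = false) :
    ∃ a : Fin n, Am.testBit a = true ∧ ∀ k,
      lvCnt n es o (fun T => T &&& 2 ^ b.val == 0) k ≤
        lvCnt n es o (fun T => T &&& (2 ^ b.val ||| Am) == 0) k +
          lvCnt n es a (fun T => T &&& 2 ^ b.val == 0) k := by
  simp only [checkLP, checkAv, List.all_eq_true, List.mem_range, Bool.or_eq_true, beq_iff_eq] at h
  have h1 := ((h o o.2 b b.2).resolve_left (fun e => hob (Fin.ext e)) Am hAm).resolve_left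
    (not_or.2 ⟨hAm0, by rw [hAo]; exact Bool.false_ne_true⟩)
  obtain ⟨a, ha, hh⟩ := List.any_eq_true.1 h1
  rw [List.mem_range] at ha
  rw [Bool.and_eq_true] at hh
  refine ⟨⟨a, ha⟩, hh.1, fun k => ?_⟩
  have hle := polyLe3_getD _ _ _ hh.2 k
  have hb2 : 2 ^ b.val < 2 ^ n := Nat.pow_lt_pow_right (by norm_num) b.2
  simp only [avTabs, getD_map_range _ _ o.2, getD_map_range _ _ ha] at hle
  rwa [getD_avTab es o hb2, getD_avTab es o (Nat.or_lt_two_pow hb2 hAm), getD_avTab es ⟨a, ha⟩ hb2] at hle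

/-! ## Anchor -/

/-- **Certificate (additive gluing, every density, the complete graph `K₅`).** The special case
`G = ⊤` on `Fin 5` of `additiveGluing_uniform_le_five` (registered anchor of this infrastructure
file). -/
theorem additiveGluing_uniform_completeFive : ∀ (p : unitInterval) (A : Finset (Fin 5)) (o b : Fin 5) (t : ℝ), 0 ≤ t → (∀ a ∈ A, 1 - t ≤ (Literature.Probability.Percolation.bondPercolation (⊤ : SimpleGraph (Fin 5)) p).real (Literature.Probability.Percolation.openConn a b)) → (Literature.Probability.Percolation.bondPercolation (⊤ : SimpleGraph (Fin 5)) p).real (⋃ a ∈ A, Literature.Probability.Percolation.openConn o a) - t ≤ (Literature.Probability.Percolation.bondPercolation (⊤ : SimpleGraph (Fin 5)) p).real (Literature.Probability.Percolation.openConn o b) := by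
  intro p A o b t ht hrel
  exact additiveGluing_uniform_le_five 5 le_rfl ⊤ p A o b t ht hrel

end Summit.CriticalPhenomena.PercolationContinuityZ3.Theorems
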